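import Summits.ValiantsHypothesis.ValiantsHypothesis.Theorems.GrenetZeonDualUnipotentThreeHalvesHeavyTopHalfSpeedDefs

/-!
# Graded / filtered profiles ⇒ FREE-RATIO word certificates; the two-level (Levi) refinement; the typed `ThinReturnLaw`
# (val-idea-31 g3, card `graded-thin-side` rev 3; crux `GrenetZeon.DualUnipotentThreeHalves` = stmt-ValiantsHypothesis-24318, residue R2)

AFTER `HALFSPEED-DEAD.md` (val-idea-30 g2, 2026-08-27): the ratio-1 laws `HalfSpeedLaw` / `HalfSpeedIrrLaw` are FALSE (inflation
`U₄ₖ`, drop/climb ratio 2), so rev 2's HalfSpeed-valued rung `GradedProfileLaw` (file `GradedProfile.lean`, this lineage) typed a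
false law.  This file RETYPES the graded-thin-side food over the free-ratio currency (`RatioSpeed ρ Θ`, here spelled out as
`RatioBound ρ Θ` because the module `Cruxes.….RatioSpeed` is not yet in the farm's library snapshot — the bridge is `Iff.rfl`):

* §1 torus-degree bookkeeping `DegGE wt a X` (= `RatioSpeed.Shifts wt a X` up to `a ≤ wt i − wt j ↔ wt j + a ≤ wt i`);
* §2 ✓ `ratioBound_of_profile` — PROFILE ⇒ FREE-RATIO BOUND: drops `≤ r`, climbs `≥ c ≥ 1`, `r ≤ ρ·c`, range `≤ Θ·c` ⇒ every
  non-zero word has `#Q ≤ Θ + ρ·#P` (general `(r, c)`; `c = 1` is val-idea-30's `ratioSpeed_of_shifts`);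
* §3 ✓ THE TWO-LEVEL REFINEMENT (answer to crit-7 P8-1 «count U₀»): degree-0 («neutral», Levi) elements that climb a SECOND
  level function inside the weight blocks are absorbed into the climbing side by the lexicographic weight `(M+1)·wt + wt'`, at the
  price `ρ ↦ (M+1)ρ + M`, `Θ ↦ (M+1)Θ + M` (`degGE_lex`, `degGE_lex_climb`, `lex_range`) — `U₀` is itself a nil space of the Levi
  `⊕ gl(blocks)` and is treated by recursion, not counted as loss;
* §4 the typed law `ThinReturnLaw` (GAUGE-INVARIANT: ONE level function in an arbitrary basis `P`; `U` drops `≤ ρ`; the non-climbing part of `U` — negative, zero AND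
  non-positive degrees, so `U₀` IS counted — has codim `≤ D/(4(ρ+1))`; height `⌊√D⌋/4`; density `C·d² ≤ D⌊√D⌋`) and ✓
  `denseRatioBound_of_thinReturnLaw` : `ThinReturnLaw → DenseRatioBoundLaw` (= `RatioSpeed.DenseRatioLaw` verbatim with the
  unfolded certificate).  `ThinReturnLaw` is STRONGER than `DenseRatioLaw` (it is α's `WeightThin` shape `(p, r, c) = (Θ, ρ, 1)` as a
  format-free matrix-space law); the card's product law (PL) / thin-side bound (PB) is the REASON it should hold on irreducible
  graded spaces.  CONJECTURES are `def`s, never asserted.  No `sorry`.  VP ≠ VNP is NOT proved; nothing here proves R2 / 24318.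
-/

noncomputable section

set_option linter.dupNamespace false
set_option autoImplicit false
set_option linter.unusedSectionVars false

namespace Summit.ValiantsHypothesis.ValiantsHypothesis.Cruxes.DualUnipotentThreeHalves.GradedThinSide

open Matrix
open Summit.ValiantsHypothesis.ValiantsHypothesis.Theorems.GrenetZeon.HalfSpeed

/-! ## §1 Torus-degree bookkeeping -/

variable {ι : Type*} [Fintype ι] [DecidableEq ι]

/-! ## Torus degree bookkeeping -/

/-- `X` has torus degree `≥ a` for the diagonal torus with integer weights `wt`:
every non-zero entry `X i j` sits at weight difference `wt i - wt j ≥ a`. -/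
def DegGE (wt : ι → ℤ) (a : ℤ) (X : Matrix ι ι ℂ) : Prop :=
  ∀ i j, X i j ≠ 0 → a ≤ wt i - wt j

theorem DegGE.mono {wt : ι → ℤ} {a b : ℤ} (h : b ≤ a) {X : Matrix ι ι ℂ} (hX : DegGE wt a X) :
    DegGE wt b X :=
  fun i j hij => h.trans (hX i j hij)

theorem degGE_zero (wt : ι → ℤ) (a : ℤ) : DegGE wt a (0 : Matrix ι ι ℂ) := by
  intro i j hij
  simp at hij

theorem degGE_one (wt : ι → ℤ) : DegGE wt 0 (1 : Matrix ι ι ℂ) := by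
  intro i j hij
  by_cases h : i = j
  · subst h; simp
  · simp [h] at hij

theorem DegGE.mul {wt : ι → ℤ} {a b : ℤ} {X Y : Matrix ι ι ℂ} (hX : DegGE wt a X) (hY : DegGE wt b Y) :
    DegGE wt (a + b) (X * Y) := by
  intro i j hij
  rw [Matrix.mul_apply] at hij
  obtain ⟨k, -, hk⟩ := Finset.exists_ne_zero_of_sum_ne_zero hij
  have h1 := hX i k (left_ne_zero_of_mul hk)
  have h2 := hY k j (right_ne_zero_of_mul hk)
  omega

theorem gword_nil' (P Q : Matrix ι ι ℂ) : gword P Q [] = 1 := by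
  simp [gword]

theorem gword_cons' (P Q : Matrix ι ι ℂ) (b : Bool) (w : List Bool) :
    gword P Q (b :: w) = (if b then Q else P) * gword P Q w := by
  simp [gword]

/-- Degree of a two-letter word: `#Q` letters of degree `≥ c` and `#P` letters of degree `≥ -r`. -/
theorem degGE_gword {wt : ι → ℤ} {r c : ℤ} {P Q : Matrix ι ι ℂ} (hP : DegGE wt (-r) P) (hQ : DegGE wt c Q)
    (w : List Bool) :
    DegGE wt (c * (w.count true : ℕ) - r * (w.count false : ℕ)) (gword P Q w) := by
  induction w with
  | nil =>
    rw [gword_nil']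
    simpa using degGE_one (ι := ι) wt
  | cons b w ih =>
    rw [gword_cons']
    cases b
    · have h := hP.mul ih
      refine h.mono (le_of_eq ?_)
      have e1 : ((List.count true (false :: w) : ℕ) : ℤ) = (List.count true w : ℕ) := by
        simp
      have e2 : ((List.count false (false :: w) : ℕ) : ℤ) = (List.count false w : ℕ) + 1 := by
        simp
      rw [e1, e2]
      ring
    · have h := hQ.mul ih
      refine h.mono (le_of_eq ?_)
      have e1 : ((List.count true (true :: w) : ℕ) : ℤ) = (List.count true w : ℕ) + 1 := by
        simp
      have e2 : ((List.count false (true :: w) : ℕ) : ℤ) = (List.count false w : ℕ) := by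
        simp
      rw [e1, e2]
      ring

theorem exists_apply_ne_zero_of_ne_zero {X : Matrix ι ι ℂ} (hX : X ≠ 0) : ∃ i j, X i j ≠ 0 := by
  by_contra h
  push Not at h
  exact hX (Matrix.ext fun i j => by simpa using h i j)

/-! ## §2 Profile ⇒ free-ratio word bound -/

/-- `RatioBound ρ Θ U T`: every non-zero word in `P ∈ U`, `Q ∈ T` has `#Q ≤ Θ + ρ·#P`.  VERBATIM `RatioSpeed.RatioSpeed ρ Θ U T`
(val-idea-30 g2, `Cruxes/DualUnipotentThreeHalves/RatioSpeed.lean`); spelled out here only because that module is not yet importable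
from the farm snapshot (bridge: `Iff.rfl`). -/
def RatioBound (ρ Θ : ℕ) (U T : Set (Matrix ι ι ℂ)) : Prop :=
  ∀ P ∈ U, ∀ Q ∈ T, ∀ w : List Bool, gword P Q w ≠ 0 → w.count true ≤ Θ + ρ * w.count false

/-- ✓ **PROFILE ⇒ FREE-RATIO BOUND.**  If every `P ∈ U` has degree `≥ -r`, every `Q ∈ T` has degree `≥ c` with `1 ≤ c`,
`r ≤ ρ·c`, and the weight range is `≤ Θ·c`, then every non-zero word has `#Q ≤ Θ + ρ·#P`
(its degree `c·#Q − r·#P` must fit under the range).  The inflation `U_{p,k}`: block weights, `c = 1`, `r = ρ = p − 2`, `Θ = p − 1`,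
`T = J_p ⊗ M_k` of codimension `1`. -/
theorem ratioBound_of_profile (wt : ι → ℤ) (r c ρ Θ : ℕ) (hc : 1 ≤ c) (hr : r ≤ ρ * c)
    (hL : ∀ i j, wt i - wt j ≤ (Θ : ℤ) * c)
    (U T : Set (Matrix ι ι ℂ)) (hU : ∀ P ∈ U, DegGE wt (-(r : ℤ)) P) (hT : ∀ Q ∈ T, DegGE wt c Q) :
    RatioBound ρ Θ U T := by
  intro P hP Q hQ w hw
  obtain ⟨i, j, hij⟩ := exists_apply_ne_zero_of_ne_zero hw
  have h1 := degGE_gword (hU P hP) (hT Q hQ) w i j hij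
  have h2 := hL i j
  have hf : (r : ℤ) * (w.count false : ℕ) ≤ ((ρ : ℤ) * c) * (w.count false : ℕ) :=
    mul_le_mul_of_nonneg_right (by exact_mod_cast hr) (by positivity)
  have h3 : (c : ℤ) * (w.count true : ℕ) ≤ (c : ℤ) * ((Θ : ℤ) + (ρ : ℤ) * (w.count false : ℕ)) := by
    nlinarith
  have h4 : ((w.count true : ℕ) : ℤ) ≤ (Θ : ℤ) + (ρ : ℤ) * (w.count false : ℕ) :=
    le_of_mul_le_mul_left h3 (by exact_mod_cast hc)
  exact_mod_cast h4

/-- The ratio-1 case (`r ≤ c`) gives β's `HalfSpeed` — a correct LEMMA; only the uniform ratio-1 LAWS are refuted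
(`HALFSPEED-DEAD.md`). -/
theorem halfSpeed_of_profile (wt : ι → ℤ) (r c Θ : ℕ) (hrc : r ≤ c) (hc : 1 ≤ c)
    (hL : ∀ i j, wt i - wt j ≤ (Θ : ℤ) * c)
    (U T : Set (Matrix ι ι ℂ)) (hU : ∀ P ∈ U, DegGE wt (-(r : ℤ)) P) (hT : ∀ Q ∈ T, DegGE wt c Q) :
    HalfSpeed Θ U T := by
  intro P hP Q hQ w hw
  have := ratioBound_of_profile wt r c 1 Θ hc (by simpa using hrc) hL U T hU hT P hP Q hQ w hw
  simpa using this

/-! ## §3 The two-level (Levi) refinement — how `U₀` is absorbed (crit-7 P8-1) -/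

/-- The lexicographic weight `(M+1)·wt + wt'` for a secondary weight `wt'` with values in `[0, M]`. -/
def lexWt (wt wt' : ι → ℤ) (M : ℕ) : ι → ℤ := fun i => ((M : ℤ) + 1) * wt i + wt' i

/-- Coarse transfer: degree `≥ a` for `wt` gives degree `≥ (M+1)a − M` for the lexicographic weight. -/
theorem degGE_lex {wt wt' : ι → ℤ} {M : ℕ} (hM : ∀ i, 0 ≤ wt' i ∧ wt' i ≤ M) {a : ℤ} {X : Matrix ι ι ℂ}
    (hX : DegGE wt a X) : DegGE (lexWt wt wt' M) (((M : ℤ) + 1) * a - M) X := by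
  intro i j hij
  have h1 := hX i j hij
  have h2 := hM i
  have h3 := hM j
  simp only [lexWt]
  nlinarith

/-- **Neutral elements that climb the secondary weight climb the lexicographic weight.**  If `X` has `wt`-degree `≥ 0` and every
entry of `wt`-degree exactly `0` climbs `wt'` (degree `≥ 1`), then `X` has lexicographic degree `≥ 1`. -/
theorem degGE_lex_climb {wt wt' : ι → ℤ} {M : ℕ} (hM : ∀ i, 0 ≤ wt' i ∧ wt' i ≤ M) {X : Matrix ι ι ℂ}
    (h0 : DegGE wt 0 X) (h1 : ∀ i j, X i j ≠ 0 → wt i = wt j → 1 ≤ wt' i - wt' j) :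
    DegGE (lexWt wt wt' M) 1 X := by
  intro i j hij
  have ha := h0 i j hij
  have h2 := hM i
  have h3 := hM j
  simp only [lexWt]
  by_cases he : wt i = wt j
  · have := h1 i j hij he
    rw [he]
    linarith
  · have hlt : wt j + 1 ≤ wt i := by omega
    nlinarith

/-- Range of the lexicographic weight: `≤ (M+1)·L + M`. -/
theorem lex_range {wt wt' : ι → ℤ} {M L : ℕ} (hM : ∀ i, 0 ≤ wt' i ∧ wt' i ≤ M) (hL : ∀ i j, wt i - wt j ≤ (L : ℤ)) :
    ∀ i j, lexWt wt wt' M i - lexWt wt wt' M j ≤ ((M : ℤ) + 1) * L + M := by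
  intro i j
  have h1 := hL i j
  have h2 := hM i
  have h3 := hM j
  simp only [lexWt]
  nlinarith

/-- ✓ **TWO-LEVEL CERTIFICATE.**  `U` drops `≤ r` for `wt` (range `≤ L`); `T ⊆ U` consists of elements of `wt`-degree `≥ 0` whose
degree-`0` entries climb `wt'` (values in `[0, M]`).  Then `RatioBound ((M+1)r + M) ((M+1)L + M) U T` — the neutral part costs a
factor `M+1` in ratio and height, NOT codimension. -/
theorem ratioBound_twoLevel (wt wt' : ι → ℤ) (r L M : ℕ) (hM : ∀ i, 0 ≤ wt' i ∧ wt' i ≤ M)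
    (hL : ∀ i j, wt i - wt j ≤ (L : ℤ)) (U T : Set (Matrix ι ι ℂ))
    (hU : ∀ P ∈ U, DegGE wt (-(r : ℤ)) P)
    (hT : ∀ Q ∈ T, DegGE wt 0 Q ∧ ∀ i j, Q i j ≠ 0 → wt i = wt j → 1 ≤ wt' i - wt' j) :
    RatioBound ((M + 1) * r + M) ((M + 1) * L + M) U T := by
  refine ratioBound_of_profile (lexWt wt wt' M) ((M + 1) * r + M) 1 ((M + 1) * r + M) ((M + 1) * L + M) le_rfl (by simp)
    ?_ U T ?_ ?_
  · intro i j
    have := lex_range (wt := wt) hM hL i j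
    push_cast
    linarith
  · intro P hP
    have := degGE_lex (wt := wt) hM (hU P hP)
    refine this.mono (le_of_eq ?_)
    push_cast
    ring
  · intro Q hQ
    obtain ⟨h0, h1⟩ := hT Q hQ
    simpa using degGE_lex_climb (wt := wt) hM h0 h1

/-! ## §4 The degree filtration piece as a submodule and the typed law -/

/-- Matrices of torus degree `≥ c` (a coordinate subspace of `M_ι(ℂ)`). -/
def degGESubmodule (wt : ι → ℤ) (c : ℤ) : Submodule ℂ (Matrix ι ι ℂ) where
  carrier := {X | DegGE wt c X}
  zero_mem' := degGE_zero wt c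
  add_mem' := by
    intro X Y hX hY i j h
    by_contra hc
    have hx : X i j = 0 := by
      by_contra hx
      exact hc (hX i j hx)
    have hy : Y i j = 0 := by
      by_contra hy
      exact hc (hY i j hy)
    exact h (by simp [hx, hy])
  smul_mem' := by
    intro a X hX i j h
    refine hX i j ?_
    intro hx
    exact h (by simp [hx])

theorem mem_degGESubmodule {wt : ι → ℤ} {c : ℤ} {X : Matrix ι ι ℂ} :
    X ∈ degGESubmodule wt c ↔ DegGE wt c X := Iff.rfl

/-! ### Change of basis (gauge): degrees are measured after conjugation `X ↦ P⁻¹ X P`; word bounds are conjugation-invariant -/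

/-- Conjugation `X ↦ Pinv * X * P` as a linear map (no invertibility needed for linearity). -/
def conjLin (Pinv P : Matrix ι ι ℂ) : Matrix ι ι ℂ →ₗ[ℂ] Matrix ι ι ℂ where
  toFun X := Pinv * X * P
  map_add' X Y := by rw [Matrix.mul_add, Matrix.add_mul]
  map_smul' c X := by rw [Matrix.mul_smul, Matrix.smul_mul, RingHom.id_apply]

theorem conjLin_apply (Pinv P X : Matrix ι ι ℂ) : conjLin Pinv P X = Pinv * X * P := rfl

theorem gword_conj (Pinv P : Matrix ι ι ℂ) (hP : P * Pinv = 1) (hP' : Pinv * P = 1) (X Y : Matrix ι ι ℂ) (w : List Bool) :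
    gword (Pinv * X * P) (Pinv * Y * P) w = Pinv * gword X Y w * P := by
  induction w with
  | nil => rw [gword_nil', gword_nil', Matrix.mul_one, hP']
  | cons b w ih =>
    rw [gword_cons', gword_cons', ih]
    cases b <;> simp only [Bool.false_eq_true, ↓reduceIte] <;>
      simp only [Matrix.mul_assoc] <;> rw [← Matrix.mul_assoc P Pinv, hP, Matrix.one_mul]

/-- Word bounds transfer from the conjugated sets back to `(U, T)`. -/
theorem ratioBound_of_conj (Pinv P : Matrix ι ι ℂ) (hP : P * Pinv = 1) (hP' : Pinv * P = 1) (ρ Θ : ℕ)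
    (U T : Set (Matrix ι ι ℂ))
    (h : RatioBound ρ Θ ((fun X => Pinv * X * P) '' U) ((fun X => Pinv * X * P) '' T)) : RatioBound ρ Θ U T := by
  intro X hX Y hY w hw
  refine h (Pinv * X * P) ⟨X, hX, rfl⟩ (Pinv * Y * P) ⟨Y, hY, rfl⟩ w ?_
  rw [gword_conj Pinv P hP hP']
  intro h0
  apply hw
  have : P * (Pinv * gword X Y w * P) * Pinv = gword X Y w := by
    simp only [Matrix.mul_assoc]
    rw [hP, Matrix.mul_one, ← Matrix.mul_assoc, hP, Matrix.one_mul]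
  rw [← this, h0, Matrix.mul_zero, Matrix.zero_mul]

/-- **`ThinReturnLaw`** (research conjecture of card `graded-thin-side` rev 3 — typed, NOT asserted; GAUGE-INVARIANT: the weight is
taken in an arbitrary basis `P`).  For every DENSE linear space `U ⊆ M_d(ℂ)` of nilpotent matrices (`C·d² ≤ D·⌊√D⌋`, `D = dim U`) there
are a basis change `P`, ONE integer weight `wt` of range `≤ ⌊√D⌋/4` and a ratio `ρ ≥ 1` such that every `P⁻¹XP`, `X ∈ U`, has degree
`≥ -ρ` («returns are shallow») and the part of `U` that does NOT climb (degree `< 1` after conjugation: the returns `U₋` AND the neutral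
part `U₀`, so `U₀` IS counted — crit-7 P8-1) has `4(ρ+1)·codim ≤ D`.  This is α's `WeightThin` shape `(P, lvl, p, r, c) = (P, wt, ⌊√D⌋/4, ρ, 1)`
as a format-free matrix-space law, and it implies val-idea-30's `DenseRatioLaw` (`denseRatioBound_of_thinReturnLaw`).  WHY IT MIGHT FAIL: a
dense irreducible nil space with BOTH sides fat for every flag — excluded on bi-inflations with commuting coefficients by the
double-centraliser product bound, conjecturally (PL) in general; see `BiInflation.lean` and `Ideas/graded-thin-side.md` rev 3. -/
def ThinReturnLaw : Prop :=
  ∃ C : ℕ, ∀ (d : ℕ) (U : Submodule ℂ (Matrix (Fin d) (Fin d) ℂ)), (∀ A ∈ U, IsNilpotent A) →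
    C * d ^ 2 ≤ Module.finrank ℂ U * Nat.sqrt (Module.finrank ℂ U) →
    ∃ (P : (Matrix (Fin d) (Fin d) ℂ)ˣ) (wt : Fin d → ℤ) (ρ : ℕ), 1 ≤ ρ ∧
      (∀ i j, wt i - wt j ≤ ((Nat.sqrt (Module.finrank ℂ U) / 4 : ℕ) : ℤ)) ∧
      (∀ X ∈ U, DegGE wt (-(ρ : ℤ)) ((↑(P⁻¹) : Matrix (Fin d) (Fin d) ℂ) * X * (P : Matrix (Fin d) (Fin d) ℂ))) ∧
      4 * (ρ + 1) * (Module.finrank ℂ U -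
        Module.finrank ℂ ↥(U ⊓ (degGESubmodule wt 1).comap
          (conjLin (↑(P⁻¹) : Matrix (Fin d) (Fin d) ℂ) (P : Matrix (Fin d) (Fin d) ℂ)))) ≤ Module.finrank ℂ U

/-- `DenseRatioBoundLaw` — VERBATIM `RatioSpeed.DenseRatioLaw` (val-idea-30 g2) with the certificate `RatioSpeed` spelled out as
`RatioBound` (bridge `Iff.rfl` once `Cruxes.….RatioSpeed` is importable); from it `heavyTopLaw_of_denseRatioLaw` gives R2 BY NAME. -/
def DenseRatioBoundLaw : Prop :=
  ∃ C : ℕ, ∀ (d : ℕ) (U : Submodule ℂ (Matrix (Fin d) (Fin d) ℂ)), (∀ A ∈ U, IsNilpotent A) →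
    C * d ^ 2 ≤ Module.finrank ℂ U * Nat.sqrt (Module.finrank ℂ U) →
    ∃ (ρ : ℕ) (T : Submodule ℂ (Matrix (Fin d) (Fin d) ℂ)), 1 ≤ ρ ∧ T ≤ U ∧
      4 * (ρ + 1) * (Module.finrank ℂ U - Module.finrank ℂ T) ≤ Module.finrank ℂ U ∧
      RatioBound ρ (Nat.sqrt (Module.finrank ℂ U) / 4) (U : Set (Matrix (Fin d) (Fin d) ℂ)) T

/-- ✓ **`ThinReturnLaw → DenseRatioBoundLaw`** (same constant; certificate `T = U ∩ P·M_{≥ 1}(wt)·P⁻¹`). -/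
theorem denseRatioBound_of_thinReturnLaw (h : ThinReturnLaw) : DenseRatioBoundLaw := by
  obtain ⟨C, hC⟩ := h
  refine ⟨C, fun d U hnil hdense => ?_⟩
  obtain ⟨P, wt, ρ, hρ, hL, hU, hcod⟩ := hC d U hnil hdense
  set Pi : Matrix (Fin d) (Fin d) ℂ := ↑(P⁻¹) with hPi
  set Pm : Matrix (Fin d) (Fin d) ℂ := ↑P with hPm
  have hP1 : Pm * Pi = 1 := by rw [hPi, hPm, ← Units.val_mul, mul_inv_cancel, Units.val_one]
  have hP2 : Pi * Pm = 1 := by rw [hPi, hPm, ← Units.val_mul, inv_mul_cancel, Units.val_one]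
  refine ⟨ρ, U ⊓ (degGESubmodule wt 1).comap (conjLin Pi Pm), hρ, inf_le_left, hcod, ?_⟩
  refine ratioBound_of_conj Pi Pm hP1 hP2 ρ _ _ _ ?_
  refine ratioBound_of_profile wt ρ 1 ρ (Nat.sqrt (Module.finrank ℂ U) / 4) le_rfl (by simp) (by simpa using hL) _ _ ?_ ?_
  · rintro _ ⟨X, hX, rfl⟩
    exact hU X hX
  · rintro _ ⟨Y, hY, rfl⟩
    have hY' : Y ∈ U ⊓ (degGESubmodule wt 1).comap (conjLin Pi Pm) := hY
    have := (Submodule.mem_inf.mp hY').2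
    rw [Submodule.mem_comap] at this
    exact (mem_degGESubmodule).mp this

/-- The IRREDUCIBLE-class form (the graded line's own target; irreducibility as in `HalfSpeedIrrLaw`).  `ThinReturnLaw` for general
`U` should follow from this one by the block-triangular glue (off-diagonal blocks climb for free; diagonal = irreducible
constituents; neutral parts by `ratioBound_twoLevel`) — that glue is NOT typed here. -/
def ThinReturnLawIrr : Prop :=
  ∃ C : ℕ, ∀ (d : ℕ) (U : Submodule ℂ (Matrix (Fin d) (Fin d) ℂ)), (∀ A ∈ U, IsNilpotent A) →
    (∀ V : Submodule ℂ (Fin d → ℂ), (∀ A ∈ U, ∀ x ∈ V, A *ᵥ x ∈ V) → V = ⊥ ∨ V = ⊤) →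
    C * d ^ 2 ≤ Module.finrank ℂ U * Nat.sqrt (Module.finrank ℂ U) →
    ∃ (P : (Matrix (Fin d) (Fin d) ℂ)ˣ) (wt : Fin d → ℤ) (ρ : ℕ), 1 ≤ ρ ∧
      (∀ i j, wt i - wt j ≤ ((Nat.sqrt (Module.finrank ℂ U) / 4 : ℕ) : ℤ)) ∧
      (∀ X ∈ U, DegGE wt (-(ρ : ℤ)) ((↑(P⁻¹) : Matrix (Fin d) (Fin d) ℂ) * X * (P : Matrix (Fin d) (Fin d) ℂ))) ∧
      4 * (ρ + 1) * (Module.finrank ℂ U -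
        Module.finrank ℂ ↥(U ⊓ (degGESubmodule wt 1).comap
          (conjLin (↑(P⁻¹) : Matrix (Fin d) (Fin d) ℂ) (P : Matrix (Fin d) (Fin d) ℂ)))) ≤ Module.finrank ℂ U

theorem thinReturnLawIrr_of_thinReturnLaw (h : ThinReturnLaw) : ThinReturnLawIrr := by
  obtain ⟨C, hC⟩ := h
  exact ⟨C, fun d U hnil _ hdense => hC d U hnil hdense⟩

end Summit.ValiantsHypothesis.ValiantsHypothesis.Cruxes.DualUnipotentThreeHalves.GradedThinSide

end
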